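import Summits.CriticalPhenomena.CardyFormulaZ2.Theses.CardyUSTContinuation
import Summits.CriticalPhenomena.CardyFormulaZ2.Theorems.CardyUSTContinuationUniformAnalyticExtensionStubZeroFreeCrossingOmits
import Literature.Analysis.Complex.CauchyTaylorBall
import Literature.Probability.LatticeModels.FKTwoArcPartitionPolynomials
import HarnessLib

/-!
# A real-axis NECESSARY condition for the crux `UniformAnalyticExtension`
# (stmt-CriticalPhenomena-6047, route `CardyUSTContinuation`, line `registered`, lead c6):
# δ-uniform factorial bounds on all `t`-derivatives of the crossing ratio on `[t₁, 1]`

Write `Z_δ = fkTwoArcPartitionPolynomials R δ .joint`, `N_δ = fkTwoArcCrossingPolynomial R δ .joint`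
(`u_R(t, δ) = N_δ(t)/Z_δ(t)` for `t, δ > 0`) and `f_δ z = N_δ(z)/Z_δ(z)` (junk-valued rational
function; near every real `t > 0` it is holomorphic, `Z_δ(t) > 0`).  The crux asks for δ-UNIFORM
`(ρ, M)` and bounded analytic extensions of `u_R(·, δ)|[t₁,1]` to the complex `ρ`-neighbourhood.

* `crux_derivBounds` — the crux implies, by Cauchy's inequalities, the δ-UNIFORM Gevrey-1 (real
  analytic) bounds `‖f_δ^{(k)}(t)‖ ≤ M · k! / rᵏ` for ALL orders `k`, all `t ∈ [t₁, 1]` and all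
  small `δ` (with `r = ρ/2`): the statement of the crux in the language of the lattice model ON
  THE REAL AXIS.  The `k`-th `t`-derivative of `u_R(·, δ)` along the self-dual line is a joint
  cumulant, under the critical FK measure, of the crossing indicator with `k` copies of the
  "energy" `H(ω) = |ω| + 2k^joint(ω)` (= number of loops + const, Euler); at `t = 1` these are
  cumulants under Bernoulli(1/2) bond percolation of `Ω_δ`.  So the crux is refutable on the real
  axis: a single order `k` whose cumulant grows faster than `M k!/rᵏ` uniformly kills it (cheap:
  exact polynomials of boxes, REPORT-c3/c5; or Monte Carlo for `k = 1, 2` at `t = 1`).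
  Conversely, such uniform bounds for all `k` on `[t₁, 1]` are EQUIVALENT to the crux (Taylor
  series; not formalised here).
* `crux_derivBounds_one` — the case `k = 1`, `t = 1` spelled out: the crux bounds
  `|∂_t u_R(1, δ)| = |Cov_δ(1_cross, H)|` uniformly in `δ`; the order-1 probe of the crux at the
  PERCOLATION end (the analogue of the proved order-1 probe `KirchhoffExtremalLength` at the tree
  end `t = 0`).

Ingredients: the landed identity theorem `omits_aeval_eq_mul` and `omits_uJ_eq_ratio` (p162728),
`Literature.Analysis.Complex.norm_iteratedDeriv_le_of_forall_mem_ball` (Cauchy's inequalities).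
-/

noncomputable section

open Filter Topology Set Polynomial Metric
open Literature.Probability.LatticeModels
open Literature.Probability.RandomPlanarGeometry (ConformalRectangle)

namespace Summit.CriticalPhenomena.CardyFormulaZ2.Cruxes.UniformAnalyticExtension.Birth

open Summit.CriticalPhenomena.CardyFormulaZ2.Theses.CardyUSTContinuation

/-- **The crux ⇒ δ-uniform Gevrey-1 bounds on the real segment.** If `UniformAnalyticExtension`
holds then for every conformal rectangle `R` and `t₁ ∈ (0,1)` there are `r > 0` and `M` such that
for all small `δ > 0`, every order `k` and every `t ∈ [t₁, 1]`,
`‖(N_δ/Z_δ)^{(k)}(t)‖ ≤ M · k! / rᵏ` (complex `k`-th derivative of the rational function at the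
real point `t`; Cauchy's inequalities for the bounded extension `g_δ`, which agrees with
`N_δ/Z_δ` near `t` by the identity theorem). [folklore] -/
theorem crux_derivBounds :
    Summit.CriticalPhenomena.CardyFormulaZ2.Theses.CardyUSTContinuation.UniformAnalyticExtension →
    ∀ R : ConformalRectangle, ∀ t₁ ∈ Set.Ioo (0:ℝ) 1, ∃ r > (0:ℝ), ∃ M : ℝ, ∀ᶠ δ in 𝓝[>] (0:ℝ),
      ∀ k : ℕ, ∀ t ∈ Set.Icc t₁ 1,
        ‖iteratedDeriv k (fun z : ℂ => aeval z (fkTwoArcCrossingPolynomial R δ ArcWiring.joint) /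
            aeval z (fkTwoArcPartitionPolynomials R δ ArcWiring.joint)) (t : ℂ)‖ ≤
          M * k.factorial / r ^ k := by
  intro hA R t₁ ht₁
  obtain ⟨ρ, hρ, M, hev⟩ := hA R t₁ ht₁
  refine ⟨ρ / 2, by positivity, M, ?_⟩
  filter_upwards [hev, self_mem_nhdsWithin] with δ hδ hδpos
  have hδ' : (0:ℝ) < δ := hδpos
  obtain ⟨g, hgd, hgM, hgu⟩ := hδ
  intro k t ht
  set S : Set ℂ := ((↑) : ℝ → ℂ) '' Set.Icc t₁ 1 with hSdef
  set N := fkTwoArcCrossingPolynomial R δ ArcWiring.joint with hNdef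
  set Z := fkTwoArcPartitionPolynomials R δ ArcWiring.joint with hZdef
  set f : ℂ → ℂ := fun z => aeval z N / aeval z Z with hfdef
  have ht0 : 0 < t := ht₁.1.trans_le ht.1
  -- `N = g · Z` on the whole neighbourhood (identity theorem)
  have hNZ : ∀ z ∈ thickening ρ S, aeval z N = g z * aeval z Z :=
    omits_aeval_eq_mul ht₁.2 hρ N Z hgd
      (fun s hs => (omits_uJ_eq_ratio R hδ' (ht₁.1.trans_le hs.1)).1)
      (fun s hs => by rw [hgu s hs]; exact (omits_uJ_eq_ratio R hδ' (ht₁.1.trans_le hs.1)).2)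
  -- near the real point `t`, `Z ≠ 0`, so `f = g` there
  have hZt : aeval (t : ℂ) Z ≠ 0 := (omits_uJ_eq_ratio R hδ' ht0).1
  have htS : (t : ℂ) ∈ thickening ρ S := self_subset_thickening hρ S ⟨t, ht, rfl⟩
  have hfg : f =ᶠ[𝓝 (t : ℂ)] g := by
    have h1 : ∀ᶠ w in 𝓝 (t : ℂ), aeval w Z ≠ 0 :=
      ((Polynomial.differentiable_aeval Z) _).continuousAt.eventually_ne hZt
    have h2 : ∀ᶠ w in 𝓝 (t : ℂ), w ∈ thickening ρ S := isOpen_thickening.mem_nhds htS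
    filter_upwards [h1, h2] with w hw1 hw2
    simp only [hfdef]
    rw [hNZ w hw2, mul_div_assoc, div_self hw1, mul_one]
  rw [(hfg.iteratedDeriv k).eq_of_nhds]
  -- Cauchy's inequalities for `g` on `ball t ρ ⊆ U_ρ`
  have hball : ball (t : ℂ) ρ ⊆ thickening ρ S := fun w hw =>
    mem_thickening_iff.2 ⟨t, ⟨t, ht, rfl⟩, mem_ball.1 hw⟩
  have hC := Literature.Analysis.Complex.norm_iteratedDeriv_le_of_forall_mem_ball hρ
    (hgd.mono hball) (fun z hz => hgM z (hball hz)) k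
  calc ‖iteratedDeriv k g (t : ℂ)‖ ≤ k.factorial * M / (ρ / 2) ^ k := hC
    _ = M * k.factorial / (ρ / 2) ^ k := by rw [mul_comm]

/-- **Order `1` at the percolation end.** Under the crux, for every conformal rectangle the first
`t`-derivative of the crossing ratio at `t = 1` — a covariance, under Bernoulli(1/2) bond
percolation of `Ω_δ`, of the crossing indicator with `|ω| + 2k^joint(ω)` — is bounded uniformly in
the mesh: `‖(N_δ/Z_δ)'(1)‖ ≤ M / r` for all small `δ`. [folklore] -/
theorem crux_derivBounds_one :
    Summit.CriticalPhenomena.CardyFormulaZ2.Theses.CardyUSTContinuation.UniformAnalyticExtension →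
    ∀ R : ConformalRectangle, ∃ C : ℝ, ∀ᶠ δ in 𝓝[>] (0:ℝ),
      ‖deriv (fun z : ℂ => aeval z (fkTwoArcCrossingPolynomial R δ ArcWiring.joint) /
          aeval z (fkTwoArcPartitionPolynomials R δ ArcWiring.joint)) 1‖ ≤ C := by
  intro hA R
  obtain ⟨r, hr, M, hev⟩ := crux_derivBounds hA R (1 / 2) (by norm_num)
  refine ⟨M * (1 : ℕ).factorial / r ^ 1, ?_⟩
  filter_upwards [hev] with δ hδ
  have := hδ 1 1 ⟨by norm_num, le_rfl⟩
  rwa [iteratedDeriv_one, Complex.ofReal_one] at this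

end Summit.CriticalPhenomena.CardyFormulaZ2.Cruxes.UniformAnalyticExtension.Birth
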